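import Literature.IUT.LogThetaLattice.PacketLogVolumesHaarModelRelLocal
import Literature.IUT.LogThetaLattice.PacketLogVolumesHaarModelRelLocalArch
import Literature.IUT.LogThetaLattice.PacketLogVolumesHaarModelNormalization
import Literature.IUT.LogVolume.CompletionLocalFields
import Literature.NumberTheory.AdelicBaseChange.CompletionBaseChange
import HarnessLib

/-!
# [IUTchIII] Proposition 3.9 (iii) at the GENUINE adelic Haar model, RELATIVE case `K ⊋ F_mod`, ASSEMBLY at
# `|A| = 1`: packets `⊕_{v ∈ 𝕍_mod, v | v_ℚ} K_{v̲}` along a section `V̲ ⥲ 𝕍_mod` of places, and the invariance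
# of the global log-volume under `F_mod^×` (abc-iut cell, layer L6 row REL39, part R2 = REL39-A)

S. Mochizuki, *Inter-universal Teichmüller theory III*, kurims manuscript (May 2020), §3, Proposition 3.9,
pp. 115–118 [claim: Mochizuki2012, status: disputed]. Printed text, (i) p. 115: "the `p_{v_ℚ}`-adic log-volume on
each of the direct summand `p_{v_ℚ}`-adic fields of `𝓘^ℚ(^α𝓕_{v_ℚ})` … together with the discussion of normalized
weights in Remark 3.1.1, (ii), (iii), (iv) — determines … log-volumes `μ^log_{α,v_ℚ} : 𝕄(𝓘^ℚ(^α𝓕_{v_ℚ})) → ℝ` …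
normalized so that multiplication of an element of "`𝕄(−)`" by `p_v` corresponds to adding the quantity
`−log(p_v) ∈ ℝ`"; p. 116 (archimedean `v_ℚ`): "the sum of the radial log-volumes on each of the direct summand
complex archimedean fields … normalized so that multiplication … by `e = 2.71828...` corresponds to adding the
quantity `1 = log(e) ∈ ℝ`"; (iii) p. 117: "by adding the log-volumes of (i) [all but finitely many of which are
zero!] at the various `v_ℚ ∈ 𝕍_ℚ`, one obtains a global log-volume `μ^log_{A,𝕍_ℚ} : 𝕄(𝓘^ℚ(^A𝓕_{𝕍_ℚ})) → ℝ`
which is invariant with respect to multiplication by elements of `(†𝕄⊛_mod)_α = (†𝕄⊛_MOD)_α ⊆ 𝓘^ℚ(^A𝓕_{𝕍_ℚ})`".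
Remark 3.1.1 (ii), p. 94: the summands are the "`K_v`" for `v ∈ V̲ ⥲ 𝕍_mod`, with "the normalized weight
`1/([K_v : (F_mod)_v]·(Σ_{𝕍_mod ∋ w | v_ℚ} [(F_mod)_w : ℚ_{v_ℚ}]))`". [IUTchI] Def. 3.1 (e), kurims p. 62: "`V̲ ⊆
V(K)` is a subset that induces a natural bijection `V̲ ⥲ V_mod`, i.e., a section of the natural surjection
`V(K) ↠ V_mod`".

WHAT THIS FILE ADDS (L6 board §F v1.19c, REL39 CONSOLIDATED SPLIT: R1-nonarch = abc-iut-L6-t5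
`PacketLogVolumesHaarModelRelLocal`, R1-arch = abc-iut-w5-d030 `…RelLocalArch`, R2 = this file, R3 = abc-iut-w5-d083
tensor packets / degree). R1 built the summands `K_w` (`relPlaceDatum F K w`, every place `w` of `K`, `F` acting
through `F ⊆ K ↪ K_w`), the weights `relHaarWeight F K w` of Remark 3.1.1 (ii), and the per-place CANCELLATION
`relHaarWeight(w)·log‖f‖_{K_w} = haarWeight_F(v)·log‖f‖_v` (`w | v`; `…_inr'`, `…_inl'`). Here:
* `GlobalPlaceSection F K` — a section `v ↦ v̲` of ALL places of `K` over those of `F` ([IUTchI] Def. 3.1 (e)):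
  campaign-S `PlaceSection F K` (finite places) extended by a lift of the archimedean places; `nonempty`,
  `liftPlace`, `below_liftPlace` (`v̲|_F = v`), `finBelow_lift`, `extension`;
* `relLocalDegree_eq_finrank`: R1's number `e(w|v)·f(w|v)` **is `[K_w : F_v]`, the degree of the extension of
  COMPLETIONS** (vendored FLT `adicCompletion.ramificationIdx_mul_inertiaDeg_eq_finrank`, Cassels–Fröhlich Ch. II
  §10); hence `relHaarWeight_inr_eq_finrank` / `relHaarWeight_inr_eq_print`: the finite weight along the section is
  Remark 3.1.1 (ii)'s `1/([K_{v̲} : F_v]·Σ_{w | p_v}[F_w : ℚ_{p_v}])` VERBATIM (campaign-S `sum_localDegree`);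
* `relHaarWeight_mul_log_modulus` (all places of `K`) and `relWeightedLogModulus_liftPlace`: along the section the
  weighted log-moduli of the relative model ARE those of abc-iut-L6-d3's model for `F`; so
  `relPacketLogModulus_eq : relPacketLogModulus F K σ f = packetLogModulus F f`;
* `relHaarPacketLogVolume F K σ v_ℚ` = the datum `μ^log_{v_ℚ}` of Prop. 3.9 (iii) on genuine regions
  `(T_v ⊆ K_{v̲})_{v | v_ℚ}`, `relHaarPrincipalAction F K σ f` = multiplication by `f ∈ F^×`, and
  **`prop39iii_invariance_haarModelRel σ : Prop39iii_invariance (relHaarPacketLogVolume F K σ)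
  (relHaarPrincipalAction F K σ)`** — the printed invariance clause HOLDS at the relative genuine model for EVERY
  finite extension of number fields `K/F` and EVERY section (abc-iut-L6-t5's `Prop39iii_invariance_of_productFormula`
  + d3's product formula `finsum_packetLogModulus_eq_zero F`); `exists_prop39iii_invariance_haarModelRel`;
* the packet-normalisations of Prop. 3.9 (i) at the relative model: `relHaarPacketLogVolume_prime_natCast_smul`
  (`μ^log_p(p·T) = μ^log_p(T) − log p`, from d3's `packetLogModulus_prime_self`: the bookkeeping
  `Σ_{v|p} [K_{v̲}:F_v]·(1/([K_{v̲}:F_v]·[F:ℚ]))·log‖p‖_v = −log p`) and `sum_relHaarWeight_liftArch` (the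
  archimedean weights along the section sum to `1`: "`×e ↦ +log e`", d030's `sum_relHaarWeight_inl_section`).

HONEST SCOPE. (1) `|A| = 1`; the tensor packets and the DEGREE clause are part R3. (2) The archimedean summand is
`ℂ` with the radial volume at every archimedean `v̲` (faithful whenever `K_{v̲} ≅ ℂ` — always for the totally
complex `K ⊇ F ∋ √−1` of [IUTchI] Def. 3.1 (b); a real `K_{v̲}` is embedded `ℝ ⊂ ℂ`). (3) Regions are ALL
positive-finite-volume families (a superset of print's `𝕄(−)`). Nothing here constructs `(†𝓕⊛_mod)_α` or a
Frobenioid, asserts anything about [IUTchIII] Cor. 3.12, or takes a side; typed ≠ endorsed. The mathematics is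
classical (Haar measure, `‖f‖_{K_w} = ‖f‖_v^{[K_w:F_v]}`, `e·f = [K_w:F_v]`, the product formula for `F`).
-/

noncomputable section

namespace Literature.IUT.LogThetaLattice

open Literature.IUT.LogVolume NumberField IsDedekindDomain MeasureTheory Metric Set
open scoped ENNReal NNReal Pointwise

variable (F K : Type) [Field F] [Field K] [Algebra F K]

/-! ### Sections `V̲ ⥲ 𝕍_mod` of all places ([IUTchI] Def. 3.1 (e)) -/

/-- **A section of ALL places of `K` over those of `F`** ([IUTchI] Def. 3.1 (e) p. 62: "`V̲ ⊆ V(K)` is a subset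
that induces a natural bijection `V̲ ⥲ V_mod`, i.e., a section of the natural surjection `V(K) ↠ V_mod`", with
`F` in the role of `F_mod`): campaign-S `PlaceSection F K` (`v ↦ v̲` on finite places, `v̲ ∩ 𝓞_F = v`) together
with a lift `w ↦ w̲` of the archimedean places (`w̲|_F = w`). [claim: Mochizuki2012, status: disputed] -/
structure GlobalPlaceSection extends PlaceSection F K where
  /-- the chosen archimedean place `w̲` of `K` over the archimedean place `w` of `F` -/
  liftArch : InfinitePlace F → InfinitePlace K
  /-- `w̲` lies over `w` -/
  comap_liftArch : ∀ w, (liftArch w).comap (algebraMap F K) = w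

namespace GlobalPlaceSection

variable {F K}

/-- Sections of all places exist (finite part: campaign-S `PlaceSection.nonempty`; archimedean part: Mathlib
`InfinitePlace.comap_surjective`). [claim: Mochizuki2012, status: disputed] -/
theorem nonempty [NumberField F] [NumberField K] : Nonempty (GlobalPlaceSection F K) := by
  obtain ⟨σ⟩ := PlaceSection.nonempty F K
  exact ⟨{ σ with
    liftArch := fun w => (InfinitePlace.comap_surjective (k := F) (K := K) w).choose
    comap_liftArch := fun w => (InfinitePlace.comap_surjective (k := F) (K := K) w).choose_spec }⟩

variable (σ : GlobalPlaceSection F K)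

/-- The lift `v ↦ v̲` on all places `𝕍(F) = 𝕍(F)^arc ⊔ 𝕍(F)^non`. [claim: Mochizuki2012, status: disputed] -/
def liftPlace : Place F → Place K := Sum.map σ.liftArch σ.lift

/-- `liftPlace (inl w) = inl w̲`. [claim: Mochizuki2012, status: disputed] -/
@[simp] theorem liftPlace_inl (w : InfinitePlace F) : σ.liftPlace (Sum.inl w) = Sum.inl (σ.liftArch w) := rfl

/-- `liftPlace (inr v) = inr v̲`. [claim: Mochizuki2012, status: disputed] -/
@[simp] theorem liftPlace_inr (v : HeightOneSpectrum (𝓞 F)) : σ.liftPlace (Sum.inr v) = Sum.inr (σ.lift v) :=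
  rfl

/-- The finite place of `F` under `v̲` is `v` (campaign-S `finBelow`). [claim: Mochizuki2012, status: disputed] -/
theorem finBelow_lift (v : HeightOneSpectrum (𝓞 F)) : finBelow F K (σ.lift v) = v :=
  HeightOneSpectrum.ext (σ.under_asIdeal_lift v)

/-- **`v̲|_F = v` on all places** (campaign-S `Place.below`): the section is a section.
[claim: Mochizuki2012, status: disputed] -/
@[simp] theorem below_liftPlace (v : Place F) : Place.below F K (σ.liftPlace v) = v := by
  rcases v with w | v
  · show Sum.inl ((σ.liftArch w).comap (algebraMap F K)) = Sum.inl w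
    rw [σ.comap_liftArch]
  · show Sum.inr (finBelow F K (σ.lift v)) = Sum.inr v
    rw [σ.finBelow_lift]

/-- The section is injective. [claim: Mochizuki2012, status: disputed] -/
theorem liftPlace_injective : Function.Injective σ.liftPlace := fun v v' h => by
  rw [← σ.below_liftPlace v, ← σ.below_liftPlace v', h]

/-- `v̲` as an element of the fibre `{w : w ∩ 𝓞_F = v}` (vendored FLT `HeightOneSpectrum.Extension`).
[claim: Mochizuki2012, status: disputed] -/
def extension [NumberField F] [NumberField K] (v : HeightOneSpectrum (𝓞 F)) : v.Extension (𝓞 K) :=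
  ⟨σ.lift v, σ.under_lift v⟩

/-- The underlying place of `σ.extension v` is `v̲`. [claim: Mochizuki2012, status: disputed] -/
@[simp] theorem extension_val [NumberField F] [NumberField K] (v : HeightOneSpectrum (𝓞 F)) :
    (σ.extension v).1 = σ.lift v := rfl

end GlobalPlaceSection

variable [NumberField F] [NumberField K]

/-! ### `e(w|v)·f(w|v) = [K_w : F_v]` as a degree of completions; the printed weight -/

/-- **`e(w|v)·f(w|v) = [K_w : F_v]`**: R1's local degree `relLocalDegree F K (inr w)` IS the degree of the
extension of completions `K_w / F_v` (vendored FLT `adicCompletion.ramificationIdx_mul_inertiaDeg_eq_finrank`,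
Cassels–Fröhlich Ch. II §10), for `w` in the fibre over `v`. [claim: Mochizuki2012, status: disputed] -/
theorem relLocalDegree_eq_finrank (v : HeightOneSpectrum (𝓞 F)) (W : v.Extension (𝓞 K)) :
    relLocalDegree F K (Sum.inr W.1) = Module.finrank (v.adicCompletion F) (W.1.adicCompletion K) := by
  obtain ⟨w, rfl⟩ := W
  haveI : (finBelow F K w).asIdeal.IsMaximal := (finBelow F K w).isMaximal
  haveI : w.asIdeal.IsMaximal := w.isMaximal
  rw [relLocalDegree_inr, Ideal.ramificationIdx'_eq_ramificationIdx (finBelow F K w).asIdeal w.asIdeal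
      (finBelow F K w).ne_bot, Ideal.inertiaDeg'_eq_inertiaDeg (finBelow F K w).asIdeal w.asIdeal]
  exact IsDedekindDomain.HeightOneSpectrum.adicCompletion.ramificationIdx_mul_inertiaDeg_eq_finrank
    (K := F) (L := K) ⟨w, rfl⟩

variable {F K} (σ : GlobalPlaceSection F K)

/-- **Remark 3.1.1 (ii) at a finite place with the GENUINE local degree**: the weight of `K_{v̲}` is
`1/([K_{v̲} : F_v]·[F : ℚ])` with `[K_{v̲} : F_v] = dim_{F_v} K_{v̲}`. [claim: Mochizuki2012, status: disputed] -/
theorem relHaarWeight_inr_eq_finrank (v : HeightOneSpectrum (𝓞 F)) :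
    relHaarWeight F K (Sum.inr (σ.lift v)) =
      1 / (Module.finrank (v.adicCompletion F) ((σ.extension v).1.adicCompletion K) * Module.finrank ℚ F) := by
  rw [relHaarWeight_inr, ← relLocalDegree_eq_finrank F K v (σ.extension v), GlobalPlaceSection.extension_val]

/-- **Remark 3.1.1 (ii) at a finite place, VERBATIM**: "`1/([K_v : (F_mod)_v]·(Σ_{𝕍_mod ∋ w | v_ℚ} [(F_mod)_w :
ℚ_{v_ℚ}]))`" — the denominator's sum over the places `w` of `F` above `p_v` of the local degrees `[F_w : ℚ_{p_v}]`
(campaign-S `localDegree`, `= [F:ℚ]` by `sum_localDegree`) times the genuine `[K_{v̲} : F_v]`.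
[claim: Mochizuki2012, status: disputed] -/
theorem relHaarWeight_inr_eq_print (v : HeightOneSpectrum (𝓞 F)) :
    relHaarWeight F K (Sum.inr (σ.lift v)) =
      1 / (Module.finrank (v.adicCompletion F) ((σ.extension v).1.adicCompletion K) *
        ∑ w ∈ placesOver F (residueChar F v), (localDegree F w : ℝ)) := by
  haveI : Fact (residueChar F v).Prime := ⟨residueChar_prime F v⟩
  rw [relHaarWeight_inr_eq_finrank, ← Nat.cast_sum, sum_localDegree F (residueChar F v)]

/-! ### The cancellation along the section -/

/-- **The weighted log-modulus of the relative summand at ANY place `w` of `K` is the weighted log-modulus of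
d3's model for `F` at the place below** (`f ∈ F^×`): R1-nonarch's `relHaarWeight_mul_log_modulus_inr'` and
R1-arch's `relHaarWeight_mul_log_modulus_inl'` glued over `𝕍(K) = 𝕍(K)^arc ⊔ 𝕍(K)^non`.
[claim: Mochizuki2012, status: disputed] -/
theorem relHaarWeight_mul_log_modulus (w : Place K) (f : Fˣ) :
    relHaarWeight F K w * Real.log ((relPlaceDatum F K w).modulus (f : F)) =
      haarWeight F (Place.below F K w) * Real.log ((placeDatum F (Place.below F K w)).modulus (f : F)) := by
  rcases w with w | w
  · exact relHaarWeight_mul_log_modulus_inl' F K w f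
  · exact relHaarWeight_mul_log_modulus_inr' F K w f

/-- Along the section: `c_{v̲}·log‖f‖_{K_{v̲}} = c_v·log‖f‖_v` for every place `v` of `F` (d3's HONEST SCOPE (1):
"the exponent cancels the factor `[K_v:(F_mod)_v]^{-1}` of the printed weight").
[claim: Mochizuki2012, status: disputed] -/
theorem relWeightedLogModulus_liftPlace (f : Fˣ) (v : Place F) :
    relHaarWeight F K (σ.liftPlace v) * Real.log ((relPlaceDatum F K (σ.liftPlace v)).modulus (f : F)) =
      haarWeight F v * Real.log ((placeDatum F v).modulus (f : F)) := by
  rw [relHaarWeight_mul_log_modulus, σ.below_liftPlace]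

/-! ### The packet log-volume `μ^log_{v_ℚ}` on genuine regions `(T_v ⊆ K_{v̲})_{v | v_ℚ}` and the action of `F^×` -/

variable (F K) in
/-- **[IUTchIII] Prop. 3.9 (i)/(iii) datum `μ^log_{v_ℚ}` at the relative genuine model**: the region at `v_ℚ` is a
family `T = (T_v)_{v ∈ 𝕍(F), v | v_ℚ}` of admissible subsets `T_v ⊆ K_{v̲}` (the direct-product region of the
1-packet `⊕_{v|v_ℚ} K_{v̲}`, indexed by `V̲ ⥲ 𝕍_mod`), and `μ^log_{v_ℚ}(T) := Σ_{v|v_ℚ} c_{v̲}·log μ_{v̲}(T_v)` with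
R1's weights `c_{v̲}` of Remark 3.1.1 (ii). [claim: Mochizuki2012, status: disputed] -/
def relHaarPacketLogVolume (q : RatPlace) (T : ∀ v : Packet F q, (relPlaceDatum F K (σ.liftPlace v.1)).Adm) : ℝ :=
  ∑ v : Packet F q, relHaarWeight F K (σ.liftPlace v.1) * (relPlaceDatum F K (σ.liftPlace v.1)).logVol (T v).1

variable (F K) in
/-- The LOCAL change of `μ^log_{v_ℚ}` under `f ∈ F^×`: `Σ_{v|v_ℚ} c_{v̲}·log‖f‖_{K_{v̲}}`.
[claim: Mochizuki2012, status: disputed] -/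
def relPacketLogModulus (f : Fˣ) (q : RatPlace) : ℝ :=
  ∑ v : Packet F q, relHaarWeight F K (σ.liftPlace v.1) * Real.log ((relPlaceDatum F K (σ.liftPlace v.1)).modulus (f : F))

/-- **The relative packet shifts ARE the absolute ones of `F`**: `Σ_{v|v_ℚ} c_{v̲}·log‖f‖_{K_{v̲}} =
Σ_{v|v_ℚ} c_v·log‖f‖_v` (d3's `packetLogModulus F f v_ℚ`), term by term by the cancellation.
[claim: Mochizuki2012, status: disputed] -/
theorem relPacketLogModulus_eq (f : Fˣ) (q : RatPlace) :
    relPacketLogModulus F K σ f q = packetLogModulus F f q :=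
  Finset.sum_congr rfl fun v _ => relWeightedLogModulus_liftPlace σ f v.1

/-- `μ^log_{v_ℚ}(f·T) = μ^log_{v_ℚ}(T) + Σ_{v|v_ℚ} c_{v̲}·log‖f‖_{K_{v̲}}`. [claim: Mochizuki2012, status: disputed] -/
theorem relHaarPacketLogVolume_actAdm (f : Fˣ) (q : RatPlace)
    (T : ∀ v : Packet F q, (relPlaceDatum F K (σ.liftPlace v.1)).Adm) :
    relHaarPacketLogVolume F K σ q (fun v => (relPlaceDatum F K (σ.liftPlace v.1)).actAdm f (T v)) =
      relHaarPacketLogVolume F K σ q T + relPacketLogModulus F K σ f q := by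
  simp only [relHaarPacketLogVolume, relPacketLogModulus, PlaceHaarDatum.logVol_actAdm, mul_add,
    Finset.sum_add_distrib]

/-- The packet shifts are finitely supported on `𝕍_ℚ` (d3's `finite_support_packetLogModulus`).
[claim: Mochizuki2012, status: disputed] -/
theorem finite_support_relPacketLogModulus (f : Fˣ) :
    (Function.support (relPacketLogModulus F K σ f)).Finite := by
  rw [show relPacketLogModulus F K σ f = packetLogModulus F f from funext (relPacketLogModulus_eq σ f)]
  exact finite_support_packetLogModulus F f

/-- **The product formula** for the relative shifts: `Σ_{v_ℚ} Σ_{v|v_ℚ} c_{v̲}·log‖f‖_{K_{v̲}} = 0` (d3's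
`finsum_packetLogModulus_eq_zero F`, the logarithm of Mathlib's `NumberField.prod_abs_eq_one`).
[claim: Mochizuki2012, status: disputed] -/
theorem finsum_relPacketLogModulus_eq_zero (f : Fˣ) : ∑ᶠ q, relPacketLogModulus F K σ f q = 0 := by
  rw [show relPacketLogModulus F K σ f = packetLogModulus F f from funext (relPacketLogModulus_eq σ f)]
  exact finsum_packetLogModulus_eq_zero F f

variable (F K) in
/-- **[IUTchIII] Prop. 3.9 (iii) "multiplication by elements of `(†𝕄⊛_mod)_α`" at the relative genuine model**:
`f ∈ F^×` acts on a global region `(T_v ⊆ K_{v̲})_v` by `T_v ↦ f·T_v` through `F ⊆ K ↪ K_{v̲}`; "zero log-volume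
for all but finitely many `v_ℚ`" is preserved (`‖f‖_{K_{v̲}} = 1` for almost all `v`).
[claim: Mochizuki2012, status: disputed] -/
def relHaarPrincipalAction (f : Fˣ) (S : GlobalRegion (relHaarPacketLogVolume F K σ)) :
    GlobalRegion (relHaarPacketLogVolume F K σ) :=
  ⟨fun q v => (relPlaceDatum F K (σ.liftPlace v.1)).actAdm f (S.1 q v), by
    refine (S.2.union (finite_support_relPacketLogModulus σ f)).subset fun q hq => ?_
    by_contra hq'
    rw [Set.mem_union, not_or, Function.notMem_support, Function.notMem_support] at hq'
    apply Function.mem_support.mp hq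
    change relHaarPacketLogVolume F K σ q (fun v => (relPlaceDatum F K (σ.liftPlace v.1)).actAdm f (S.1 q v)) = 0
    rw [relHaarPacketLogVolume_actAdm, hq'.1, hq'.2, add_zero]⟩

/-- Components of `f·S`. [claim: Mochizuki2012, status: disputed] -/
@[simp] theorem relHaarPrincipalAction_apply (f : Fˣ) (S : GlobalRegion (relHaarPacketLogVolume F K σ))
    (q : RatPlace) (v : Packet F q) :
    (relHaarPrincipalAction F K σ f S).1 q v = (relPlaceDatum F K (σ.liftPlace v.1)).actAdm f (S.1 q v) := rfl

/-- **IUTchIII:Prop3.9(iii)** (kurims p. 117) INVARIANCE CLAUSE AT THE RELATIVE GENUINE HAAR MODEL (`K ⊋ F_mod`,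
L6 row REL39): `Prop39iii_invariance (relHaarPacketLogVolume F K σ) (relHaarPrincipalAction F K σ)` HOLDS for
EVERY finite extension of number fields `K/F` and EVERY section `σ : V̲ ⥲ 𝕍(F)` — "a global log-volume … which is
invariant with respect to multiplication by elements of `(†𝕄⊛_mod)_α`", for the printed packets `⊕_{v|v_ℚ} K_{v̲}`
with their Haar / radial volumes and the normalized weights `1/([K_{v̲}:F_v]·[F:ℚ])` of Remark 3.1.1 (ii):
abc-iut-L6-t5's `Prop39iii_invariance_of_productFormula` fed with the local law `μ^log_{v_ℚ}(f·T) =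
μ^log_{v_ℚ}(T) + Σ_{v|v_ℚ} c_{v̲}·log‖f‖_{K_{v̲}}` and the product formula for `F` after the cancellation
`c_{v̲}·log‖f‖_{K_{v̲}} = (1/[F:ℚ])·log‖f‖_v`. [claim: Mochizuki2012, status: disputed] -/
theorem prop39iii_invariance_haarModelRel :
    Prop39iii_invariance (relHaarPacketLogVolume F K σ) (relHaarPrincipalAction F K σ) :=
  Prop39iii_invariance_of_productFormula (relHaarPacketLogVolume F K σ) (relHaarPrincipalAction F K σ)
    (relPacketLogModulus F K σ) (finite_support_relPacketLogModulus σ) (finsum_relPacketLogModulus_eq_zero σ)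
    (fun f S q => relHaarPacketLogVolume_actAdm σ f q (S.1 q))

/-- The invariance unfolded: `μ^log_{𝕍_ℚ}(f·S) = μ^log_{𝕍_ℚ}(S)`. [claim: Mochizuki2012, status: disputed] -/
theorem globalLogVolume_relHaarPrincipalAction (f : Fˣ) (S : GlobalRegion (relHaarPacketLogVolume F K σ)) :
    globalLogVolume (relHaarPacketLogVolume F K σ) (relHaarPrincipalAction F K σ f S) =
      globalLogVolume (relHaarPacketLogVolume F K σ) S :=
  prop39iii_invariance_haarModelRel σ f S

variable (F K) in
/-- Sections exist over every `K/F`, so the invariance clause is realised by SOME relative genuine model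
(non-vacuity of the binder `σ`). [claim: Mochizuki2012, status: disputed] -/
theorem exists_prop39iii_invariance_haarModelRel : ∃ σ : GlobalPlaceSection F K,
    Prop39iii_invariance (relHaarPacketLogVolume F K σ) (relHaarPrincipalAction F K σ) := by
  obtain ⟨σ⟩ := GlobalPlaceSection.nonempty (F := F) (K := K)
  exact ⟨σ, prop39iii_invariance_haarModelRel σ⟩

/-! ### The packet-normalisations of Prop. 3.9 (i) at the relative model -/

/-- **Nonarchimedean packet-normalisation, AS PRINTED** ([IUTchIII] Prop. 3.9 (i) p. 115: "multiplication of an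
element of "`𝕄(−)`" by `p_v` corresponds to adding the quantity `−log(p_v) ∈ ℝ`") for EVERY region `T =
(T_v ⊆ K_{v̲})_{v|p}` of the relative packet at `p`: `μ^log_p(p·T) = μ^log_p(T) − log p` — the bookkeeping
`Σ_{v|p} (1/([K_{v̲}:F_v]·[F:ℚ]))·[K_{v̲}:F_v]·log‖p‖_v = (1/[F:ℚ])·Σ_{v|p} log‖p‖_v = −log p` (d3's
`packetLogModulus_prime_self`, campaign-S `sum_localDegree`). [claim: Mochizuki2012, status: disputed] -/
theorem relHaarPacketLogVolume_prime_natCast_smul (p : Nat.Primes)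
    (T : ∀ v : Packet F (RatPlace.prime p), (relPlaceDatum F K (σ.liftPlace v.1)).Adm) :
    relHaarPacketLogVolume F K σ (RatPlace.prime p) (fun v => (relPlaceDatum F K (σ.liftPlace v.1)).actAdm
        (Units.mk0 ((p : ℕ) : F) (by exact_mod_cast p.2.ne_zero)) (T v)) =
      relHaarPacketLogVolume F K σ (RatPlace.prime p) T - Real.log p := by
  rw [relHaarPacketLogVolume_actAdm, relPacketLogModulus_eq, packetLogModulus_prime_self, sub_eq_add_neg]

/-- **Archimedean packet-normalisation bookkeeping** ([IUTchIII] Prop. 3.9 (i) p. 116 "`×e ↦ +log e`"): the weights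
of the complex summands `K_{w̲}`, `w ∈ 𝕍(F)^arc`, of the relative archimedean packet sum to `1` (R1-arch's
`sum_relHaarWeight_inl_section`, d3's `sum_haarWeight_arch`). [claim: Mochizuki2012, status: disputed] -/
theorem sum_relHaarWeight_liftArch : ∑ w : InfinitePlace F, relHaarWeight F K (Sum.inl (σ.liftArch w)) = 1 :=
  sum_relHaarWeight_inl_section F K σ.liftArch σ.comap_liftArch

end Literature.IUT.LogThetaLattice

end
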